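import Literature.Geometry.Riemannian.SphericalZonalKernelSeriesDeriv
import Literature.Analysis.SpecialFunctions.GegenbauerOrthogonality
import Mathlib.MeasureTheory.Integral.DominatedConvergence
import Mathlib.Algebra.Polynomial.Sequence
import HarnessLib

/-!
# Duality for the `S⁶` zonal heat series: `∫ (1-s²)² zonalSix(τ,s) p(s) ds = h₀ (P_τ p)(1) ≥ 0`

Third file on the typed zonal heat series of `SphericalCylinderEntropy` (after
`SphericalZonalKernelSeries.lean`, `SphericalZonalKernelSeriesDeriv.lean`).  For `τ > 0` the `S⁶`
series `zonalSix τ s = ∑_j e^{-j(j+5)τ} (2j+5)/5 · C_j^{(5/2)}(s)` is tested against polynomials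
written in the Gegenbauer basis, `p = Σ_{j<J} b_j C_j^{(5/2)}` (the time-`0` value of the polynomial
heat flow `gegenbauerHeat 2 b J` of `GegenbauerHeatPositivity.lean`):

* `gegenSix_eq_gegenbauerSum` — `gegenSix j = gegenbauerSum (2 + 1/2) j` (same explicit sum);
* `hasSum_integral_weight_mul_term_mul` — dominated convergence: for continuous `g`,
  `Σ_i ∫_{-1}^{1} (1-s²)² (wtSix i τ C_i(s)) g(s) ds = ∫_{-1}^{1} (1-s²)² zonalSix(τ,s) g(s) ds`
  (uniform majorant of `SphericalZonalKernelSeries` on `[-1,1]`);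
* `integral_weight_mul_zonalSix_mul_gegenbauerHeat` — **duality**: by orthogonality and the norm
  identity `(j + 5/2) h_j = (5/2) h₀ C_j(1)` (`GegenbauerOrthogonality.gegenbauerNormSq_eq`), i.e.
  `(2j+5)/5 · h_j = h₀ C_j(1)`,
  `∫ (1-s²)² zonalSix(τ,s) p(s) ds = h₀ · Σ_{j<J} b_j e^{-j(j+5)τ} C_j(1) = h₀ (P_τ p)(1)`;
* `integral_weight_mul_zonalSix_mul_nonneg_of_gegenbauerHeat` — hence `≥ 0` whenever `p ≥ 0` on
  `[-1,1]`, by positivity preservation (`gegenbauerHeat_nonneg`);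
* `exists_gegenbauerHeat_eq_eval` — every real polynomial is such a `p` (the `C_j^{(5/2)}`, as
  elements of `ℝ[X]`, have exact degree `j`: `degree_gegenSixPoly`, `Polynomial.Sequence.span_degreeLT`),
  and
  `integral_weight_mul_zonalSix_mul_eval_nonneg` — `∫ (1-s²)² zonalSix(τ,s) q(s) ds ≥ 0` for every
  polynomial `q ≥ 0` on `[-1,1]`.

The conclusion `zonalSix ≥ 0` (polynomial approximation) is in `SphericalZonalSixPositivity.lean`.
Everything is proved; no named facts.

## References
* E. B. Davies, *Heat Kernels and Spectral Theory*, CUP 1989, Ch. 5.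
* G. E. Andrews, R. Askey, R. Roy, *Special Functions*, CUP 1999, §6.4, §9.6.
-/

noncomputable section

open scoped BigOperators Topology Nat Polynomial Interval
open Filter Set MeasureTheory intervalIntegral Polynomial
open Literature.Geometry.Riemannian.SphericalCylinderEntropy
open Literature.Analysis.SpecialFunctions

namespace Literature.Geometry.Riemannian.SphericalZonalKernelSeries

/-! ### The `S⁶` objects in terms of the general Gegenbauer sums (`k = 2`, `a = 5/2`) -/

/-- `gegenSix j = C_j^{(2 + 1/2)}` as explicit sums. [folklore] -/
theorem gegenSix_eq_gegenbauerSum (j : ℕ) (s : ℝ) :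
    gegenSix j s = gegenbauerSum (((2 : ℕ) : ℝ) + 1 / 2) j s := by
  have h : (((2 : ℕ) : ℝ) + 1 / 2) = (5 : ℝ) / 2 := by norm_num
  rw [h]
  simp only [gegenSix, gegenbauerSum, gegenbauerCoeff]

/-- The `S⁶` weight against the squared norm: `wtSix j τ · (j + 5/2) = e^{-j(j+5)τ} (5/2) (2j+5)/5`,
in the form `wtSix j τ = e^{-j(j+2·2+1)τ} · ((j + a)/a)` with `a = 2 + 1/2`. [folklore] -/
theorem wtSix_eq (j : ℕ) (τ : ℝ) :
    wtSix j τ = Real.exp (-((j : ℝ) * ((j : ℝ) + 2 * (2 : ℕ) + 1) * τ)) *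
      (((j : ℝ) + (((2 : ℕ) : ℝ) + 1 / 2)) / (((2 : ℕ) : ℝ) + 1 / 2)) := by
  unfold wtSix
  have h : Real.exp (-((j : ℝ) * ((j : ℝ) + 5)) * τ) =
      Real.exp (-((j : ℝ) * ((j : ℝ) + 2 * (2 : ℕ) + 1) * τ)) := by
    congr 1; push_cast; ring
  rw [h]
  push_cast
  congr 1
  field_simp
  ring

/-- `gegenSix j` is continuous. [folklore] -/
theorem continuous_gegenSix (j : ℕ) : Continuous (gegenSix j) := by
  unfold gegenSix; fun_prop

/-! ### Interchanging the series and the integral on `[-1, 1]` -/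

/-- **Dominated convergence**: for continuous `g`, the term-wise integrals
`∫_{-1}^{1} (1-s²)² (wtSix i τ C_i(s)) g(s) ds` sum to `∫_{-1}^{1} (1-s²)² zonalSix(τ,s) g(s) ds`.
[folklore] -/
theorem hasSum_integral_weight_mul_term_mul {τ : ℝ} (hτ : 0 < τ) {g : ℝ → ℝ} (hg : Continuous g) :
    HasSum (fun i : ℕ => ∫ s in (-1 : ℝ)..1, (1 - s ^ 2) ^ 2 * (wtSix i τ * gegenSix i s) * g s)
      (∫ s in (-1 : ℝ)..1, (1 - s ^ 2) ^ 2 * zonalSix τ s * g s) := by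
  -- a bound for `|(1-s²)² g|` on `[-1, 1]`
  obtain ⟨M, hM⟩ := isCompact_Icc.exists_bound_of_continuousOn (s := Icc (-1 : ℝ) 1)
    ((by fun_prop : Continuous fun s : ℝ => (1 - s ^ 2) ^ 2 * g s).continuousOn)
  set u : ℕ → ℝ := fun i =>
    Real.exp (-(i : ℝ) ^ 2 * τ) * (((i + 3).factorial : ℕ) : ℝ) ^ 2 * (2 * 1) ^ i with hu
  have hus : Summable u := summable_majorant hτ (by norm_num)
  have hIoc : Ι (-1 : ℝ) 1 = Set.Ioc (-1) 1 := Set.uIoc_of_le (by norm_num)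
  refine intervalIntegral.hasSum_integral_of_dominated_convergence (fun i _ => u i * M)
    (fun i => ?_) (fun i => ae_of_all _ fun s hs => ?_) (ae_of_all _ fun s _ => hus.mul_right M)
    intervalIntegrable_const (ae_of_all _ fun s _ => ?_)
  · have hc := continuous_gegenSix i
    exact (by fun_prop : Continuous fun s : ℝ => (1 - s ^ 2) ^ 2 * (wtSix i τ * gegenSix i s) *
      g s).aestronglyMeasurable
  · rw [hIoc] at hs
    have hs1 : |s| ≤ 1 := abs_le.2 ⟨hs.1.le, hs.2⟩
    have h1 := norm_wtSix_mul_gegenSix_le hτ le_rfl hs1 i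
    have h2 := hM s ⟨hs.1.le, hs.2⟩
    rw [show (1 - s ^ 2) ^ 2 * (wtSix i τ * gegenSix i s) * g s =
      (wtSix i τ * gegenSix i s) * ((1 - s ^ 2) ^ 2 * g s) by ring, norm_mul]
    exact mul_le_mul h1 h2 (norm_nonneg _) ((norm_nonneg _).trans h1)
  · have h := ((summable_wtSix_mul_gegenSix hτ s).hasSum.mul_left ((1 - s ^ 2) ^ 2)).mul_right (g s)
    refine h.congr_fun ?_
    intro i
    ring

/-! ### Duality against the polynomial heat flow -/

/-- The term-wise integrals against `p = Σ_{j<J} b_j C_j` (`= gegenbauerHeat 2 b J · 0`):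
`∫ (1-s²)² (wtSix i τ C_i) p = wtSix i τ · b_i h_i` for `i < J` and `0` otherwise (orthogonality).
[folklore] -/
theorem integral_weight_mul_term_mul_gegenbauerHeat (τ : ℝ) (b : ℕ → ℝ) (J i : ℕ) :
    ∫ s in (-1 : ℝ)..1, (1 - s ^ 2) ^ 2 * (wtSix i τ * gegenSix i s) * gegenbauerHeat 2 b J s 0 =
      if i < J then wtSix i τ * b i * ∫ s in (-1 : ℝ)..1, (1 - s ^ 2) ^ 2 *
        (gegenbauerSum (((2 : ℕ) : ℝ) + 1 / 2) i s * gegenbauerSum (((2 : ℕ) : ℝ) + 1 / 2) i s)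
      else 0 := by
  set a : ℝ := ((2 : ℕ) : ℝ) + 1 / 2 with ha
  have hc : ∀ m : ℕ, Continuous (gegenbauerSum a m) := continuous_gegenbauerSum a
  -- expand `p` and pull the finite sum out of the integral
  have hp : ∀ s : ℝ, (1 - s ^ 2) ^ 2 * (wtSix i τ * gegenSix i s) * gegenbauerHeat 2 b J s 0 =
      ∑ j ∈ Finset.range J, wtSix i τ * b j *
        ((1 - s ^ 2) ^ 2 * (gegenbauerSum a i s * gegenbauerSum a j s)) := by
    intro s
    simp only [gegenbauerHeat, mul_zero, neg_zero, Real.exp_zero, mul_one, gegenSix_eq_gegenbauerSum,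
      Finset.mul_sum]
    refine Finset.sum_congr rfl fun j _ => ?_
    ring
  simp_rw [hp]
  rw [intervalIntegral.integral_finsetSum fun j _ =>
    ((by fun_prop : Continuous fun s : ℝ => wtSix i τ * b j *
      ((1 - s ^ 2) ^ 2 * (gegenbauerSum a i s * gegenbauerSum a j s))).intervalIntegrable _ _)]
  simp_rw [intervalIntegral.integral_const_mul]
  split_ifs with hi
  · rw [Finset.sum_eq_single_of_mem i (Finset.mem_range.2 hi)]
    intro j _ hji
    rw [integral_weight_mul_gegenbauerSum_mul_eq_zero 2 (Ne.symm hji), mul_zero]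
  · refine Finset.sum_eq_zero fun j hj => ?_
    have hji : i ≠ j := by
      intro h; exact hi (h ▸ Finset.mem_range.1 hj)
    rw [integral_weight_mul_gegenbauerSum_mul_eq_zero 2 hji, mul_zero]

/-- **Duality**: `∫_{-1}^{1} (1-s²)² zonalSix(τ,s) p(s) ds = h₀ · (P_τ p)(1)` for
`p = Σ_{j<J} b_j C_j^{(5/2)}`, where `P_τ p = gegenbauerHeat 2 b J · τ` is the polynomial heat flow and
`h₀ = ∫_{-1}^{1} (1-s²)²` (orthogonality, `(2j+5)/5 · h_j = h₀ C_j(1)`). [folklore] -/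
theorem integral_weight_mul_zonalSix_mul_gegenbauerHeat {τ : ℝ} (hτ : 0 < τ) (b : ℕ → ℝ) (J : ℕ) :
    ∫ s in (-1 : ℝ)..1, (1 - s ^ 2) ^ 2 * zonalSix τ s * gegenbauerHeat 2 b J s 0 =
      (∫ s in (-1 : ℝ)..1, (1 - s ^ 2) ^ 2) * gegenbauerHeat 2 b J 1 τ := by
  set a : ℝ := ((2 : ℕ) : ℝ) + 1 / 2 with ha
  have hpc : Continuous fun s => gegenbauerHeat 2 b J s 0 :=
    (continuous_gegenbauerHeat 2 b J).comp (Continuous.prodMk_left (0 : ℝ))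
  have h1 := hasSum_integral_weight_mul_term_mul hτ hpc
  -- the term-wise integrals form a finitely supported sequence
  set c : ℕ → ℝ := fun i => if i < J then wtSix i τ * b i * ∫ s in (-1 : ℝ)..1, (1 - s ^ 2) ^ 2 *
    (gegenbauerSum a i s * gegenbauerSum a i s) else 0 with hcdef
  have h2 : HasSum c (∑ i ∈ Finset.range J, c i) := by
    refine hasSum_sum_of_ne_finset_zero fun i hi => ?_
    simp only [hcdef, if_neg (fun h => hi (Finset.mem_range.2 h))]
  have h1' : HasSum c (∫ s in (-1 : ℝ)..1, (1 - s ^ 2) ^ 2 * zonalSix τ s * gegenbauerHeat 2 b J s 0) := by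
    refine h1.congr_fun fun i => ?_
    rw [hcdef]
    exact (integral_weight_mul_term_mul_gegenbauerHeat τ b J i).symm
  rw [h1'.unique h2]
  -- evaluate the finite sum with the norm identity
  unfold gegenbauerHeat
  rw [Finset.mul_sum]
  refine Finset.sum_congr rfl fun i hi => ?_
  have hiJ := Finset.mem_range.1 hi
  simp only [hcdef, if_pos hiJ]
  have hn := gegenbauerNormSq_eq 2 i
  rw [wtSix_eq]
  set h0 := ∫ s in (-1 : ℝ)..1, (1 - s ^ 2) ^ 2
  set hi' := ∫ s in (-1 : ℝ)..1, (1 - s ^ 2) ^ 2 * (gegenbauerSum a i s * gegenbauerSum a i s)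
  set G := gegenbauerSum (((2 : ℕ) : ℝ) + 1 / 2) i 1 with hG
  set e := Real.exp (-((i : ℝ) * ((i : ℝ) + 2 * (2 : ℕ) + 1) * τ)) with he
  push_cast at hn ⊢
  have ha0 : (2 : ℝ) + 1 / 2 ≠ 0 := by norm_num
  have key : ((i : ℝ) + (2 + 1 / 2)) / (2 + 1 / 2) * hi' = h0 * G := by
    rw [div_mul_eq_mul_div, div_eq_iff ha0]
    linear_combination hn
  calc e * (((i : ℝ) + (2 + 1 / 2)) / (2 + 1 / 2)) * b i * hi'
      = e * b i * (((i : ℝ) + (2 + 1 / 2)) / (2 + 1 / 2) * hi') := by ring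
    _ = e * b i * (h0 * G) := by rw [key]
    _ = h0 * (b i * e * G) := by ring

/-- `h₀ = ∫_{-1}^{1} (1-s²)² > 0`. [folklore] -/
theorem integral_weight_pos : 0 < ∫ s in (-1 : ℝ)..1, (1 - s ^ 2) ^ 2 :=
  intervalIntegral.intervalIntegral_pos_of_pos_on
    ((by fun_prop : Continuous fun s : ℝ => (1 - s ^ 2) ^ 2).intervalIntegrable _ _)
    (fun s hs => ultrasphericalWeight_pos 2 hs) (by norm_num)

/-- **Positivity of the pairing**: if `p = Σ_{j<J} b_j C_j^{(5/2)} ≥ 0` on `[-1,1]` then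
`∫_{-1}^{1} (1-s²)² zonalSix(τ,s) p(s) ds ≥ 0` (duality + positivity preservation). [folklore] -/
theorem integral_weight_mul_zonalSix_mul_nonneg_of_gegenbauerHeat {τ : ℝ} (hτ : 0 < τ) (b : ℕ → ℝ)
    (J : ℕ) (h0 : ∀ s ∈ Icc (-1 : ℝ) 1, 0 ≤ gegenbauerHeat 2 b J s 0) :
    0 ≤ ∫ s in (-1 : ℝ)..1, (1 - s ^ 2) ^ 2 * zonalSix τ s * gegenbauerHeat 2 b J s 0 := by
  rw [integral_weight_mul_zonalSix_mul_gegenbauerHeat hτ]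
  exact mul_nonneg integral_weight_pos.le
    (gegenbauerHeat_nonneg 2 b J h0 hτ.le ⟨by norm_num, le_rfl⟩)

/-! ### Every polynomial is a finite Gegenbauer combination -/

/-- `C_j^{(5/2)}` as an element of `ℝ[X]`, `Σ_l c_l 2^{j-2l} X^{j-2l}`, evaluates to the explicit sum
`gegenbauerSum (2 + 1/2) j`. [folklore] -/
theorem eval_gegenSixPoly (j : ℕ) (s : ℝ) :
    (∑ l ∈ Finset.range (j / 2 + 1), C (gegenbauerCoeff (((2 : ℕ) : ℝ) + 1 / 2) j l *
      2 ^ (j - 2 * l)) * X ^ (j - 2 * l) : ℝ[X]).eval s = gegenbauerSum (((2 : ℕ) : ℝ) + 1 / 2) j s := by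
  unfold gegenbauerSum
  rw [eval_finsetSum]
  refine Finset.sum_congr rfl fun l _ => ?_
  rw [eval_mul, eval_C, eval_pow, eval_X, mul_pow]
  ring

/-- Its coefficient of `X^j` is `c_0 2^j = (a)_j 2^j / j!`. [folklore] -/
theorem coeff_gegenSixPoly_self (j : ℕ) :
    (∑ l ∈ Finset.range (j / 2 + 1), C (gegenbauerCoeff (((2 : ℕ) : ℝ) + 1 / 2) j l *
      2 ^ (j - 2 * l)) * X ^ (j - 2 * l) : ℝ[X]).coeff j =
      gegenbauerCoeff (((2 : ℕ) : ℝ) + 1 / 2) j 0 * 2 ^ j := by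
  rw [finsetSum_coeff, Finset.sum_eq_single_of_mem 0 (Finset.mem_range.2 (by omega))]
  · rw [Nat.mul_zero, Nat.sub_zero, coeff_C_mul_X_pow]
    simp
  · intro l hl hl0
    have := Finset.mem_range.1 hl
    rw [coeff_C_mul_X_pow, if_neg (by omega)]

/-- `C_j^{(5/2)}` has degree exactly `j` in `ℝ[X]` (its leading coefficient `(a)_j 2^j/j!` is
positive). [folklore] -/
theorem degree_gegenSixPoly (j : ℕ) :
    (∑ l ∈ Finset.range (j / 2 + 1), C (gegenbauerCoeff (((2 : ℕ) : ℝ) + 1 / 2) j l *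
      2 ^ (j - 2 * l)) * X ^ (j - 2 * l) : ℝ[X]).degree = j := by
  refine degree_eq_of_le_of_coeff_ne_zero ?_ ?_
  · refine (degree_le_natDegree).trans ?_
    rw [Nat.cast_le]
    refine natDegree_sum_le_of_forall_le _ _ fun l _ => ?_
    exact (natDegree_C_mul_X_pow_le _ _).trans (by omega)
  · rw [coeff_gegenSixPoly_self, gegenbauerCoeff]
    have hp : 0 < ∏ i ∈ Finset.range (j - 0), ((((2 : ℕ) : ℝ) + 1 / 2) + (i : ℝ)) :=
      Finset.prod_pos fun i _ => by positivity
    positivity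

/-- **Every real polynomial is a finite Gegenbauer combination**: `q = Σ_{j<J} b_j C_j^{(5/2)}` on
`ℝ`, i.e. `q.eval = gegenbauerHeat 2 b J · 0` for some `J`, `b` (the `C_j^{(5/2)}` form a
`Polynomial.Sequence` with unit leading coefficients, `Polynomial.Sequence.span_degreeLT`). [folklore] -/
theorem exists_gegenbauerHeat_eq_eval (q : ℝ[X]) :
    ∃ (J : ℕ) (b : ℕ → ℝ), ∀ s : ℝ, gegenbauerHeat 2 b J s 0 = q.eval s := by
  set S : Polynomial.Sequence ℝ := ⟨fun j => ∑ l ∈ Finset.range (j / 2 + 1),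
    C (gegenbauerCoeff (((2 : ℕ) : ℝ) + 1 / 2) j l * 2 ^ (j - 2 * l)) * X ^ (j - 2 * l),
    degree_gegenSixPoly⟩ with hSdef
  have hS : ∀ j : ℕ, (S : ℕ → ℝ[X]) j = ∑ l ∈ Finset.range (j / 2 + 1),
      C (gegenbauerCoeff (((2 : ℕ) : ℝ) + 1 / 2) j l * 2 ^ (j - 2 * l)) * X ^ (j - 2 * l) :=
    fun j => rfl
  set m := q.natDegree + 1 with hm
  have hspan := Polynomial.Sequence.span_degreeLT S (m := m) fun i _ =>
    isUnit_iff_ne_zero.2 (leadingCoeff_ne_zero.2 (S.ne_zero i))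
  have hq : q ∈ Polynomial.degreeLT ℝ m := by
    rw [Polynomial.mem_degreeLT]
    exact (degree_le_natDegree).trans_lt (by rw [hm]; exact_mod_cast Nat.lt_succ_self _)
  rw [← hspan] at hq
  have hset : (S : ℕ → ℝ[X]) '' Set.Iio m = Set.range (fun i : Fin m => (S : ℕ → ℝ[X]) i) := by
    ext p
    simp only [Set.mem_image, Set.mem_Iio, Set.mem_range]
    constructor
    · rintro ⟨i, hi, rfl⟩
      exact ⟨⟨i, hi⟩, rfl⟩
    · rintro ⟨i, rfl⟩
      exact ⟨i, i.is_lt, rfl⟩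
  rw [hset, Submodule.mem_span_range_iff_exists_fun] at hq
  obtain ⟨c, hc⟩ := hq
  refine ⟨m, fun j => if h : j < m then c ⟨j, h⟩ else 0, fun s => ?_⟩
  have hqe : q = ∑ j ∈ Finset.range m, (if h : j < m then c ⟨j, h⟩ else 0) • (S : ℕ → ℝ[X]) j := by
    rw [← hc, ← Fin.sum_univ_eq_sum_range (fun j =>
      (if h : j < m then c ⟨j, h⟩ else 0) • (S : ℕ → ℝ[X]) j)]
    refine Finset.sum_congr rfl fun i _ => ?_
    simp [i.is_lt]
  rw [hqe, eval_finsetSum]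
  unfold gegenbauerHeat
  refine Finset.sum_congr rfl fun j hj => ?_
  have hjm := Finset.mem_range.1 hj
  simp only [dif_pos hjm, smul_eq_mul, eval_smul, mul_zero, neg_zero, Real.exp_zero, mul_one]
  congr 1
  rw [hS]
  exact (eval_gegenSixPoly j s).symm

/-- **`∫_{-1}^{1} (1-s²)² zonalSix(τ,s) q(s) ds ≥ 0` for every real polynomial `q ≥ 0` on `[-1,1]`.**
[folklore] -/
theorem integral_weight_mul_zonalSix_mul_eval_nonneg {τ : ℝ} (hτ : 0 < τ) (q : ℝ[X])
    (hq : ∀ s ∈ Icc (-1 : ℝ) 1, 0 ≤ q.eval s) :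
    0 ≤ ∫ s in (-1 : ℝ)..1, (1 - s ^ 2) ^ 2 * zonalSix τ s * q.eval s := by
  obtain ⟨J, b, hb⟩ := exists_gegenbauerHeat_eq_eval q
  simp_rw [← hb]
  exact integral_weight_mul_zonalSix_mul_nonneg_of_gegenbauerHeat hτ b J fun s hs => (hb s).symm ▸ hq s hs

end Literature.Geometry.Riemannian.SphericalZonalKernelSeries
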